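import Literature.MathematicalPhysics.QuantumFieldTheory.Balaban1983to89.Beta.LeadingCoefficient

/-!
# `Balaban1983to89.Beta.ShellRiemann` — the dyadic lattice coefficient of a homogeneous kernel IS its continuum shell
integral (β sub-cell, lead's kernel node BETA-LEAD-SHELLRIEMANN; closes the formal half of cell GAPS G-beta-an3-5)

HONEST FRAMING (cell rule, verbatim): discharging `BetaPertH` makes Bałaban's UV stability UNCONDITIONAL — a real
constructive-QFT result; it is NOT the continuum limit and NOT the Clay problem.  (Gloss, BETA-SPEC v1.8d/v1.9b
l. 17–18, GAPS G-ref2-14 (a) / G-ref2-20 (a), verbatim: «UNCONDITIONAL» in [Balaban1989LargeFieldII] (B16) p. 355's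
interval-hypothesis sense ONLY
(`FlowStepRuns.p355Unconditional_of_partialSums` keeps `hnodes`); the located leaves G-adv3-2 (left inequality of
(0.1)/(2.50), d = 4), G-adv3-1 (U2 transfer of B14 Cor. 3's lower bound) and `SecondExpLeaf` REMAIN.)
THIS MODULE DISCHARGES NOTHING of the
series and asserts nothing about Bałaban's β-functions: it is elementary real analysis on `ℝ⁴` (Riemann sums of a
Lipschitz function over the sup-norm shell), composed BY NAME with the lead's kernel `Beta.DyadicShell` /
`Beta.WindowLog` / `Beta.LargeLWindow` and with row an3's `Beta.LeadingCoefficient`.  Every declaration is `[folklore]`.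
Value = a kernel identity for the CLASS of leading kernels (audit cell `pub-balaban`, β sub-cell, unit
`b2b-balaban-strat-b12` gen 5; specs `BETA-SPEC.md` v1.9 §8.6 (r), `MISSING-B12.md` v3.5 §12), NOT summit progress.
v1.1 (unit `b2b-balaban-strat-b12` gen 6): DOCSTRING-ONLY — the framing gloss above added (G-ref2-20 (a)); every
declaration, statement and proof is byte-identical to v1 (p179534, commit 4d84e38a5a6b).

WHAT IS PROVED (0 sorry; Mathlib measure theory + the imports above).  For `F : ℝ⁴ → ℝ` a
`DyadicShell.HomogKernel F A Λ` (positively homogeneous of degree `−4`, `|F| ≤ A` on the unit sup-sphere, `Λ`-Lipschitz on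
the closed shell `1/2 ≤ ‖x‖_∞ ≤ 2`) and the continuum shell `shell = {x : 1 < ‖x‖_∞ ≤ 2}`:
* §1 pointwise facts: `|F x| ≤ A/‖x‖⁴`, `|F x| ≤ A` for `‖x‖ ≥ 1`, and the transported Lipschitz bound
  `|F x − F y| ≤ (Λ/32)‖x − y‖` on the big shell `1 ≤ ‖x‖, ‖y‖ ≤ 4` (halve, use the hypothesis, rescale);
* §2 the sup-norm layers `layer a b = {a < ‖x‖_∞ ≤ b}` (differences of closed sup-balls), their volume `(2b)⁴ − (2a)⁴`,
  the big shell is compact and `F` is continuous, hence integrable, on it;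
* §3 the scaled lattice cubes `cube N w = Π_i [w_i/N, (w_i+1)/N)`: measurable, volume `N⁻⁴`, pairwise disjoint, within
  sup-distance `1/N` of the anchor `w/N`; a cube anchored in the lattice annulus `N < ‖w‖_∞ ≤ 2N` lies in
  `{1 < ‖x‖ ≤ 2 + 1/N}`; conversely every point with `1 + 1/N ≤ ‖x‖ ≤ 2` lies in such a cube (floor anchor);
* §4 the tiled set `tiled N = ⋃_{N<‖w‖_∞≤2N} cube N w` and the two boundary layers:
  `shell \ tiled N ⊆ layer 1 (1+1/N)`, `tiled N \ shell ⊆ layer 2 (2+1/N)`;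
* §5 THE ESTIMATE, for every `N ≥ 1`:  `|Σ_{N<‖w‖_∞≤2N} F(w) − ∫_shell F| ≤ (1280·A + 20·Λ)/N`
  (homogeneity `F(w) = N⁻⁴F(w/N)` turns the dyadic sum into the anchor Riemann sum of mesh `1/N`; the in-cube error is
  `≤ (Λ/32)·N⁻⁵` per cube times `≤ (4N+1)⁴ ≤ 625N⁴` cubes; the boundary error is `A × (240 + 1040)/N`);
* §6 THE IDENTIFICATION: `dyadicRate_integral : DyadicRate (shellSum (F∘toReal)) (∫ x in shell, F x) (1280A + 20Λ)`,
  hence (`LargeLWindow.dyadicRate_unique`) ANY dyadic coefficient `I` of the class equals `∫_shell F`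
  (`coeff_eq_integral`), and the window logarithm of `DyadicShell.windowLog_of_homogKernel` has slope
  `(∫_shell F)/log 2` (`windowLog_integral`);
* §7 for the transverse structure `T_{μν} = 24x_μ²x_ν²/|x|₂⁸` of `Beta.LeadingCoefficient`:
  `unitCoeff μ ν = ∫ x in shell, transverseUnit μ ν x` (`unitCoeff_eq_integral`), so the integral is `≥ 2⁻¹⁹ > 0`, and
  the VALUE binder `hval : unitCoeff μ ν = transverseValue` of `LeadingCoefficient.logGrowthLower_of_value` becomes the
  pure calculus statement `∫_{1<‖x‖_∞≤2} T_{μν} = 2π²·log 2` (`logGrowthLower_of_integral`; the Euclidean evaluation of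
  that definite integral is NOT done here — see AN3.md v3 §6.3 (a) for the paper computation and (c) for two engines).

WHY (BETA-SPEC v1.9 §7.8 (vi) / §8.6 (r)): with this file «lattice window coefficient = continuum coefficient» is a
THEOREM for the whole `HomogKernel` class, so the identification of Bałaban's one-loop slope with a continuum number is
PURELY the structural statement that his Ward-reorganised window kernel is `κ·T∘toReal + O(‖w‖_∞⁻⁵)` (rows (L1)–(L3)),
plus calculus.  Nothing here depends on, or says anything about, that structural statement.
-/

namespace Literature.MathematicalPhysics.QuantumFieldTheory.Balaban1983to89.Beta.ShellRiemann

open MeasureTheory Finset Real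
open Literature.Probability.LatticeModels (box mem_box card_box annulus mem_annulus)
open Literature.MathematicalPhysics.QuantumFieldTheory.Balaban1983to89.Beta.DyadicShell (Pt supNorm HomogKernel toReal
  toReal_apply norm_toReal dyadicSum mem_annulus_iff ne_zero_of_mem_annulus supNorm_pos toReal_eq_zero_iff
  exists_eq_supNorm natAbs_le_supNorm dyadicBlock_shellSum_eq windowLog_of_homogKernel)
open Literature.MathematicalPhysics.QuantumFieldTheory.Balaban1983to89.Beta.WindowLog (dyadicBlock DyadicRate shellSum)
open Literature.MathematicalPhysics.QuantumFieldTheory.Balaban1983to89.Beta.LargeL (LogGrowthLower)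
open Literature.MathematicalPhysics.QuantumFieldTheory.Balaban1983to89.Beta.LargeLWindow (WindowDecomposition
  dyadicRate_unique)
open Literature.MathematicalPhysics.QuantumFieldTheory.Balaban1983to89.Beta.LeadingCoefficient (abs_apply_le_norm
  transverseUnit leadingIntegrand unitCoeff unitCoeff_rate unitCoeff_pos unitCoeff_ge homogKernel_transverseUnit
  transverseValue logGrowthLower_of_value)

noncomputable section

variable {F : (Fin 4 → ℝ) → ℝ} {A Λ : ℝ}

/-! ## 1. Pointwise consequences of `HomogKernel` on `ℝ⁴` -/

/-- Some coordinate realises the sup norm: `‖x‖_∞ = |x_i|`. [folklore] -/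
theorem exists_norm_eq_abs (x : Fin 4 → ℝ) : ∃ i, ‖x‖ = |x i| := by
  obtain ⟨i, -, hi⟩ := Finset.exists_max_image Finset.univ (fun i => |x i|) Finset.univ_nonempty
  refine ⟨i, le_antisymm ?_ ?_⟩
  · exact (pi_norm_le_iff_of_nonneg (abs_nonneg _)).mpr fun j => by
      rw [Real.norm_eq_abs]; exact hi j (Finset.mem_univ j)
  · have h := norm_le_pi_norm x i
    rwa [Real.norm_eq_abs] at h

/-- `|F x| ≤ A/‖x‖⁴` for `x ≠ 0` (bound on the unit sphere + homogeneity). [folklore] -/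
theorem abs_le_div (hF : HomogKernel F A Λ) {x : Fin 4 → ℝ} (hx : x ≠ 0) : |F x| ≤ A / ‖x‖ ^ 4 := by
  have hn : 0 < ‖x‖ := norm_pos_iff.mpr hx
  set y : Fin 4 → ℝ := ‖x‖⁻¹ • x with hy
  have hy1 : ‖y‖ = 1 := by rw [hy, norm_smul, norm_inv, norm_norm, inv_mul_cancel₀ hn.ne']
  have hy0 : y ≠ 0 := by
    intro h; rw [h, norm_zero] at hy1; exact zero_ne_one hy1
  have hxy : x = ‖x‖ • y := by rw [hy, smul_smul, mul_inv_cancel₀ hn.ne', one_smul]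
  have key : F x = F y / ‖x‖ ^ 4 := by
    conv_lhs => rw [hxy]
    exact hF.homog ‖x‖ hn y hy0
  rw [key, abs_div, abs_of_pos (pow_pos hn 4)]
  exact div_le_div_of_nonneg_right (hF.bound y hy1) (pow_pos hn 4).le

/-- `|F x| ≤ A` once `‖x‖_∞ ≥ 1`. [folklore] -/
theorem abs_le_of_one_le_norm (hF : HomogKernel F A Λ) {x : Fin 4 → ℝ} (hx : 1 ≤ ‖x‖) : |F x| ≤ A := by
  have hx0 : x ≠ 0 := by
    intro h; rw [h, norm_zero] at hx; linarith
  refine (abs_le_div hF hx0).trans ?_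
  rw [div_le_iff₀ (by positivity)]
  have h4 : (1 : ℝ) ≤ ‖x‖ ^ 4 := one_le_pow₀ hx
  nlinarith [hF.nonneg_A]

/-- **TRANSPORTED LIPSCHITZ BOUND** on the big shell `1 ≤ ‖x‖_∞, ‖y‖_∞ ≤ 4`: `|F x − F y| ≤ (Λ/32)‖x − y‖`
(`F z = F(z/2)/16`, and `z/2` lies in the hypothesis' shell). [folklore] -/
theorem abs_sub_le_bigShell (hF : HomogKernel F A Λ) {x y : Fin 4 → ℝ} (hx1 : 1 ≤ ‖x‖) (hx4 : ‖x‖ ≤ 4)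
    (hy1 : 1 ≤ ‖y‖) (hy4 : ‖y‖ ≤ 4) : |F x - F y| ≤ Λ / 32 * ‖x - y‖ := by
  have hx0 : x ≠ 0 := by
    intro h; rw [h, norm_zero] at hx1; linarith
  have hy0 : y ≠ 0 := by
    intro h; rw [h, norm_zero] at hy1; linarith
  have hh : (0 : ℝ) < 1 / 2 := by norm_num
  have hn : ∀ z : Fin 4 → ℝ, ‖(1 / 2 : ℝ) • z‖ = ‖z‖ / 2 := fun z => by
    rw [norm_smul, Real.norm_of_nonneg hh.le]; ring
  have ex : F x = F ((1 / 2 : ℝ) • x) / 16 := by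
    rw [hF.homog (1 / 2) hh x hx0]; ring
  have ey : F y = F ((1 / 2 : ℝ) • y) / 16 := by
    rw [hF.homog (1 / 2) hh y hy0]; ring
  have hlip := hF.lip ((1 / 2 : ℝ) • x) ((1 / 2 : ℝ) • y) (by rw [hn]; linarith) (by rw [hn]; linarith)
    (by rw [hn]; linarith) (by rw [hn]; linarith)
  rw [← smul_sub, hn] at hlip
  rw [ex, ey, ← sub_div, abs_div, abs_of_pos (by norm_num : (0 : ℝ) < 16),
    div_le_iff₀ (by norm_num : (0 : ℝ) < 16)]
  calc |F ((1 / 2 : ℝ) • x) - F ((1 / 2 : ℝ) • y)| ≤ Λ * (‖x - y‖ / 2) := hlip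
    _ = Λ / 32 * ‖x - y‖ * 16 := by ring

/-! ## 2. Sup-norm layers of `ℝ⁴`, the shell, the big shell -/

/-- The sup-norm layer `{a < ‖x‖_∞ ≤ b}`, as a difference of closed sup-balls. [folklore] -/
def layer (a b : ℝ) : Set (Fin 4 → ℝ) := Metric.closedBall 0 b \ Metric.closedBall 0 a

/-- Membership in a layer. [folklore] -/
theorem mem_layer {a b : ℝ} {x : Fin 4 → ℝ} : x ∈ layer a b ↔ a < ‖x‖ ∧ ‖x‖ ≤ b := by
  rw [layer, Set.mem_sdiff, mem_closedBall_zero_iff, mem_closedBall_zero_iff, not_le]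
  exact and_comm

/-- Layers are measurable. [folklore] -/
theorem measurableSet_layer (a b : ℝ) : MeasurableSet (layer a b) :=
  measurableSet_closedBall.diff measurableSet_closedBall

/-- Layers have finite volume. [folklore] -/
theorem volume_layer_lt_top (a b : ℝ) : volume (layer a b) < ⊤ :=
  lt_of_le_of_lt (measure_mono Set.sdiff_subset) (isCompact_closedBall (0 : Fin 4 → ℝ) b).measure_lt_top

/-- **VOLUME OF A LAYER**: `(2b)⁴ − (2a)⁴` for `0 ≤ a ≤ b` (sup-balls are cubes). [folklore] -/
theorem volume_layer_toReal {a b : ℝ} (ha : 0 ≤ a) (hab : a ≤ b) :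
    (volume (layer a b)).toReal = (2 * b) ^ 4 - (2 * a) ^ 4 := by
  have hb : 0 ≤ b := ha.trans hab
  have hsub : Metric.closedBall (0 : Fin 4 → ℝ) a ⊆ Metric.closedBall 0 b :=
    Metric.closedBall_subset_closedBall hab
  have hva := Real.volume_pi_closedBall (0 : Fin 4 → ℝ) ha
  have hvb := Real.volume_pi_closedBall (0 : Fin 4 → ℝ) hb
  simp only [Fintype.card_fin] at hva hvb
  have hfin : volume (Metric.closedBall (0 : Fin 4 → ℝ) a) ≠ ⊤ := by
    rw [hva]; exact ENNReal.ofReal_ne_top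
  rw [layer, measure_sdiff hsub measurableSet_closedBall.nullMeasurableSet hfin, hva, hvb,
    ENNReal.toReal_sub_of_le (ENNReal.ofReal_le_ofReal (by gcongr)) ENNReal.ofReal_ne_top,
    ENNReal.toReal_ofReal (by positivity), ENNReal.toReal_ofReal (by positivity)]

/-- The continuum shell `S = {1 < ‖x‖_∞ ≤ 2}`. [folklore] -/
def shell : Set (Fin 4 → ℝ) := layer 1 2

/-- Membership in the shell. [folklore] -/
theorem mem_shell {x : Fin 4 → ℝ} : x ∈ shell ↔ 1 < ‖x‖ ∧ ‖x‖ ≤ 2 := mem_layer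

/-- The shell is measurable. [folklore] -/
theorem measurableSet_shell : MeasurableSet shell := measurableSet_layer 1 2

/-- The shell has volume `4⁴ − 2⁴ = 240`. [folklore] -/
theorem volume_shell_toReal : (volume shell).toReal = 240 := by
  rw [shell, volume_layer_toReal zero_le_one (by norm_num)]; norm_num

/-- The big shell `T = {1 ≤ ‖x‖_∞ ≤ 4}` (compact; `F` is Lipschitz on it). [folklore] -/
def bigShell : Set (Fin 4 → ℝ) := Metric.closedBall 0 4 ∩ {x | 1 ≤ ‖x‖}

/-- Membership in the big shell. [folklore] -/
theorem mem_bigShell {x : Fin 4 → ℝ} : x ∈ bigShell ↔ 1 ≤ ‖x‖ ∧ ‖x‖ ≤ 4 := by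
  rw [bigShell, Set.mem_inter_iff, mem_closedBall_zero_iff, Set.mem_setOf_eq]
  exact and_comm

/-- The big shell is compact. [folklore] -/
theorem isCompact_bigShell : IsCompact bigShell :=
  (isCompact_closedBall (0 : Fin 4 → ℝ) 4).inter_right (isClosed_le continuous_const continuous_norm)

/-- `shell ⊆ bigShell`. [folklore] -/
theorem shell_subset_bigShell : shell ⊆ bigShell := fun x hx => by
  rw [mem_shell] at hx
  rw [mem_bigShell]
  exact ⟨hx.1.le, by linarith [hx.2]⟩

/-- `F` is continuous on the big shell (Lipschitz there). [folklore] -/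
theorem continuousOn_bigShell (hF : HomogKernel F A Λ) : ContinuousOn F bigShell := by
  rw [Metric.continuousOn_iff]
  intro x hx ε hε
  obtain ⟨hx1, hx4⟩ := mem_bigShell.mp hx
  have hK : 0 < Λ / 32 + 1 := by linarith [hF.nonneg_Λ]
  refine ⟨ε / (Λ / 32 + 1), div_pos hε hK, fun y hy hxy => ?_⟩
  obtain ⟨hy1, hy4⟩ := mem_bigShell.mp hy
  rw [dist_eq_norm] at hxy
  rw [Real.dist_eq]
  calc |F y - F x| ≤ Λ / 32 * ‖y - x‖ := abs_sub_le_bigShell hF hy1 hy4 hx1 hx4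
    _ ≤ (Λ / 32 + 1) * ‖y - x‖ := by gcongr; linarith
    _ < (Λ / 32 + 1) * (ε / (Λ / 32 + 1)) := by gcongr
    _ = ε := by rw [← mul_div_assoc, mul_div_cancel_left₀ ε hK.ne']

/-- `F` is integrable on the big shell. [folklore] -/
theorem integrableOn_bigShell (hF : HomogKernel F A Λ) : IntegrableOn F bigShell volume :=
  (continuousOn_bigShell hF).integrableOn_compact isCompact_bigShell

/-! ## 3. Scaled lattice cubes -/

/-- The lattice cube of mesh `1/N` anchored at `w/N`: `Q_N(w) = Π_i [w_i/N, (w_i+1)/N)`. [folklore] -/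
def cube (N : ℕ) (w : Pt) : Set (Fin 4 → ℝ) :=
  Set.univ.pi fun i => Set.Ico ((N : ℝ)⁻¹ * (w i : ℝ)) ((N : ℝ)⁻¹ * ((w i : ℝ) + 1))

/-- Membership in a cube, coordinatewise. [folklore] -/
theorem mem_cube_iff {N : ℕ} {w : Pt} {x : Fin 4 → ℝ} :
    x ∈ cube N w ↔ ∀ i, (N : ℝ)⁻¹ * (w i : ℝ) ≤ x i ∧ x i < (N : ℝ)⁻¹ * ((w i : ℝ) + 1) := by
  rw [cube, Set.mem_univ_pi]
  simp only [Set.mem_Ico]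

/-- Cubes are measurable. [folklore] -/
theorem measurableSet_cube (N : ℕ) (w : Pt) : MeasurableSet (cube N w) :=
  MeasurableSet.univ_pi fun _ => measurableSet_Ico

/-- The volume of a cube is `N⁻⁴`. [folklore] -/
theorem volume_cube_toReal {N : ℕ} (hN : 0 < N) (w : Pt) : (volume (cube N w)).toReal = ((N : ℝ)⁻¹) ^ 4 := by
  have hδ : 0 < (N : ℝ)⁻¹ := inv_pos.mpr (by exact_mod_cast hN)
  have hside : ∀ i : Fin 4, (N : ℝ)⁻¹ * ((w i : ℝ) + 1) - (N : ℝ)⁻¹ * (w i : ℝ) = (N : ℝ)⁻¹ := fun i => by ring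
  unfold cube
  rw [Real.volume_pi_Ico_toReal (fun i => by
    show (N : ℝ)⁻¹ * (w i : ℝ) ≤ (N : ℝ)⁻¹ * ((w i : ℝ) + 1)
    nlinarith)]
  simp only [hside, Finset.prod_const, Finset.card_univ, Fintype.card_fin]

/-- Cubes have finite volume. [folklore] -/
theorem volume_cube_lt_top (N : ℕ) (w : Pt) : volume (cube N w) < ⊤ := by
  unfold cube
  rw [Real.volume_pi_Ico]
  exact ENNReal.prod_lt_top fun _ _ => ENNReal.ofReal_lt_top

/-- **DISTINCT LATTICE POINTS GIVE DISJOINT CUBES.** [folklore] -/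
theorem disjoint_cube {N : ℕ} (hN : 0 < N) {w w' : Pt} (h : w ≠ w') : Disjoint (cube N w) (cube N w') := by
  obtain ⟨i, hi⟩ : ∃ i, w i ≠ w' i := Function.ne_iff.1 h
  have hδ : 0 < (N : ℝ)⁻¹ := inv_pos.mpr (by exact_mod_cast hN)
  refine Set.disjoint_univ_pi.2 ⟨i, ?_⟩
  rw [Set.Ico_disjoint_Ico]
  rcases lt_or_gt_of_ne hi with hlt | hlt
  · have h' : (w i : ℝ) + 1 ≤ (w' i : ℝ) := by exact_mod_cast (show w i + 1 ≤ w' i by omega)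
    rw [min_eq_left (by nlinarith), max_eq_right (by nlinarith)]
    nlinarith
  · have h' : (w' i : ℝ) + 1 ≤ (w i : ℝ) := by exact_mod_cast (show w' i + 1 ≤ w i by omega)
    rw [min_eq_right (by nlinarith), max_eq_left (by nlinarith)]
    nlinarith

/-- A point of a cube is within sup-distance `1/N` of the anchor `w/N`. [folklore] -/
theorem norm_sub_anchor_le {N : ℕ} (hN : 0 < N) {w : Pt} {x : Fin 4 → ℝ} (hx : x ∈ cube N w) :
    ‖x - (N : ℝ)⁻¹ • toReal w‖ ≤ (N : ℝ)⁻¹ := by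
  have hδ : 0 < (N : ℝ)⁻¹ := inv_pos.mpr (by exact_mod_cast hN)
  refine (pi_norm_le_iff_of_nonneg hδ.le).mpr fun i => ?_
  obtain ⟨h1, h2⟩ := mem_cube_iff.mp hx i
  rw [Pi.sub_apply, Pi.smul_apply, toReal_apply, smul_eq_mul, Real.norm_eq_abs, abs_le]
  constructor <;> nlinarith

/-- Coordinates of a point of a cube: `|x_i| ≤ (|w_i| + 1)/N`. [folklore] -/
theorem abs_apply_le_of_mem_cube {N : ℕ} (hN : 0 < N) {w : Pt} {x : Fin 4 → ℝ} (hx : x ∈ cube N w)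
    (i : Fin 4) : |x i| ≤ (N : ℝ)⁻¹ * (|(w i : ℝ)| + 1) := by
  have hδ : 0 < (N : ℝ)⁻¹ := inv_pos.mpr (by exact_mod_cast hN)
  obtain ⟨h1, h2⟩ := mem_cube_iff.mp hx i
  rw [abs_le]
  constructor
  · nlinarith [neg_abs_le (w i : ℝ)]
  · nlinarith [le_abs_self (w i : ℝ)]

/-- Sup norm of a point of a cube: `‖x‖ ≤ (‖w‖_∞ + 1)/N`. [folklore] -/
theorem norm_le_of_mem_cube {N : ℕ} (hN : 0 < N) {w : Pt} {x : Fin 4 → ℝ} (hx : x ∈ cube N w) :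
    ‖x‖ ≤ (N : ℝ)⁻¹ * ((supNorm w : ℝ) + 1) := by
  have hδ : 0 < (N : ℝ)⁻¹ := inv_pos.mpr (by exact_mod_cast hN)
  refine (pi_norm_le_iff_of_nonneg (by positivity)).mpr fun i => ?_
  rw [Real.norm_eq_abs]
  refine (abs_apply_le_of_mem_cube hN hx i).trans ?_
  have hwi : |(w i : ℝ)| ≤ (supNorm w : ℝ) := by
    have h := abs_apply_le_norm (toReal w) i
    rwa [norm_toReal, toReal_apply] at h
  gcongr

/-- A cube anchored in the lattice annulus `N < ‖w‖_∞` lies outside the closed unit sup-ball: `1 < ‖x‖`. [folklore] -/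
theorem one_lt_norm_of_mem_cube {N : ℕ} (hN : 0 < N) {w : Pt} (hw : N < supNorm w) {x : Fin 4 → ℝ}
    (hx : x ∈ cube N w) : 1 < ‖x‖ := by
  obtain ⟨i, hi⟩ := exists_eq_supNorm w
  obtain ⟨h1, h2⟩ := mem_cube_iff.mp hx i
  have hNr : (0 : ℝ) < N := by exact_mod_cast hN
  have hcases : (N : ℤ) + 1 ≤ w i ∨ w i ≤ -((N : ℤ) + 1) := by omega
  have key : 1 < |x i| := by
    rcases hcases with hp | hn
    · have hp' : (N : ℝ) + 1 ≤ (w i : ℝ) := by exact_mod_cast hp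
      have hxi : 1 < x i := by
        calc (1 : ℝ) < (N : ℝ)⁻¹ * ((N : ℝ) + 1) := by
              rw [mul_add, inv_mul_cancel₀ hNr.ne', mul_one]; linarith [inv_pos.mpr hNr]
          _ ≤ (N : ℝ)⁻¹ * (w i : ℝ) := by gcongr
          _ ≤ x i := h1
      exact lt_of_lt_of_le hxi (le_abs_self _)
    · have hn' : (w i : ℝ) ≤ -((N : ℝ) + 1) := by exact_mod_cast hn
      have hxi : x i < -1 := by
        calc x i < (N : ℝ)⁻¹ * ((w i : ℝ) + 1) := h2
          _ ≤ (N : ℝ)⁻¹ * (-(N : ℝ)) := by gcongr; linarith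
          _ = -1 := by rw [mul_neg, inv_mul_cancel₀ hNr.ne']
      have : 1 < -x i := by linarith
      exact lt_of_lt_of_le this (neg_le_abs _)
  exact lt_of_lt_of_le key (abs_apply_le_norm x i)

/-- The sup norm of the anchor: `‖w/N‖_∞ = ‖w‖_∞/N`. [folklore] -/
theorem norm_anchor {N : ℕ} (hN : 0 < N) (w : Pt) : ‖(N : ℝ)⁻¹ • toReal w‖ = (supNorm w : ℝ) / N := by
  have hNr : (0 : ℝ) < N := by exact_mod_cast hN
  rw [norm_smul, norm_inv, Real.norm_of_nonneg hNr.le, norm_toReal, div_eq_inv_mul]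

/-- **HOMOGENEITY ON THE LATTICE**: `N⁻⁴·F(w/N) = F(w)` for `w ≠ 0`. [folklore] -/
theorem pow_mul_apply_anchor (hF : HomogKernel F A Λ) {N : ℕ} (hN : 0 < N) {w : Pt} (hw : w ≠ 0) :
    ((N : ℝ)⁻¹) ^ 4 * F ((N : ℝ)⁻¹ • toReal w) = F (toReal w) := by
  have hNr : (0 : ℝ) < N := by exact_mod_cast hN
  have hx : (N : ℝ)⁻¹ • toReal w ≠ 0 := by
    intro h
    rw [smul_eq_zero] at h
    rcases h with h | h
    · exact (inv_ne_zero hNr.ne') h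
    · exact hw (toReal_eq_zero_iff.mp h)
  have h := hF.homog N hNr _ hx
  rw [smul_smul, mul_inv_cancel₀ hNr.ne', one_smul] at h
  rw [h, inv_pow, div_eq_mul_inv, mul_comm]

/-- The floor anchor of a point: `w_i = ⌊N x_i⌋`. [folklore] -/
def anchor (N : ℕ) (x : Fin 4 → ℝ) : Pt := fun i => ⌊(N : ℝ) * x i⌋

/-- Every point lies in the cube of its floor anchor. [folklore] -/
theorem mem_cube_anchor {N : ℕ} (hN : 0 < N) (x : Fin 4 → ℝ) : x ∈ cube N (anchor N x) := by
  have hNr : (0 : ℝ) < N := by exact_mod_cast hN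
  refine mem_cube_iff.mpr fun i => ?_
  have h1 := Int.floor_le ((N : ℝ) * x i)
  have h2 := Int.lt_floor_add_one ((N : ℝ) * x i)
  simp only [anchor]
  constructor
  · rw [inv_mul_le_iff₀ hNr]; exact h1
  · rw [lt_inv_mul_iff₀ hNr]; exact h2

/-- **COVERING**: a point with `1 + 1/N ≤ ‖x‖_∞ ≤ 2` has its floor anchor in the lattice annulus `N < ‖w‖_∞ ≤ 2N`.
[folklore] -/
theorem anchor_mem_annulus {N : ℕ} (hN : 0 < N) {x : Fin 4 → ℝ} (h1 : 1 + (N : ℝ)⁻¹ ≤ ‖x‖) (h2 : ‖x‖ ≤ 2) :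
    anchor N x ∈ annulus 4 N (2 * N) := by
  have hNr : (0 : ℝ) < N := by exact_mod_cast hN
  rw [mem_annulus]
  constructor
  · rw [mem_box]
    intro i
    obtain ⟨hlo, hhi⟩ := abs_le.mp ((abs_apply_le_norm x i).trans h2)
    have hf1 := Int.floor_le ((N : ℝ) * x i)
    have hf2 := Int.lt_floor_add_one ((N : ℝ) * x i)
    constructor
    · have h : ((-((2 * N : ℕ) : ℤ) : ℤ) : ℝ) < (anchor N x i : ℝ) + 1 := by
        push_cast
        simp only [anchor]
        nlinarith
      have h' : -((2 * N : ℕ) : ℤ) < anchor N x i + 1 := by exact_mod_cast h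
      omega
    · have h : (anchor N x i : ℝ) ≤ (((2 * N : ℕ) : ℤ) : ℝ) := by
        push_cast
        simp only [anchor]
        nlinarith
      exact_mod_cast h
  · rw [mem_box, not_forall]
    obtain ⟨i, hi⟩ := exists_norm_eq_abs x
    refine ⟨i, fun hh => ?_⟩
    obtain ⟨hlo, hhi⟩ := hh
    have hf1 := Int.floor_le ((N : ℝ) * x i)
    rw [hi] at h1
    rcases le_or_gt 0 (x i) with hpos | hneg
    · rw [abs_of_nonneg hpos] at h1
      have hNx : (N : ℝ) + 1 ≤ (N : ℝ) * x i := by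
        have := mul_le_mul_of_nonneg_left h1 hNr.le
        rwa [mul_add, mul_inv_cancel₀ hNr.ne', mul_one] at this
      have hle : (N : ℤ) + 1 ≤ anchor N x i := Int.le_floor.mpr (by push_cast; exact hNx)
      omega
    · rw [abs_of_neg hneg] at h1
      have hNx : (N : ℝ) * x i ≤ -((N : ℝ) + 1) := by
        have := mul_le_mul_of_nonneg_left h1 hNr.le
        rw [mul_add, mul_inv_cancel₀ hNr.ne', mul_one] at this
        linarith
      have h' : (anchor N x i : ℝ) ≤ -((N : ℝ) + 1) := hf1.trans hNx
      have hle : anchor N x i ≤ -((N : ℤ) + 1) := by exact_mod_cast h'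
      omega

/-! ## 4. The tiled set and the two boundary layers -/

/-- The union of the cubes anchored in the lattice annulus `N < ‖w‖_∞ ≤ 2N`. [folklore] -/
def tiled (N : ℕ) : Set (Fin 4 → ℝ) := ⋃ w ∈ annulus 4 N (2 * N), cube N w

/-- Membership in the tiled set. [folklore] -/
theorem mem_tiled {N : ℕ} {x : Fin 4 → ℝ} : x ∈ tiled N ↔ ∃ w ∈ annulus 4 N (2 * N), x ∈ cube N w := by
  simp only [tiled, Set.mem_iUnion, exists_prop]

/-- The tiled set is measurable. [folklore] -/
theorem measurableSet_tiled (N : ℕ) : MeasurableSet (tiled N) :=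
  Finset.measurableSet_biUnion _ fun w _ => measurableSet_cube N w

/-- **OUTER CONTAINMENT**: `tiled N ⊆ {1 < ‖x‖_∞ ≤ 2 + 1/N}`. [folklore] -/
theorem tiled_subset {N : ℕ} (hN : 0 < N) : tiled N ⊆ layer 1 (2 + (N : ℝ)⁻¹) := by
  intro x hx
  obtain ⟨w, hw, hxw⟩ := mem_tiled.mp hx
  obtain ⟨hw1, hw2⟩ := mem_annulus_iff.mp hw
  have hNr : (0 : ℝ) < N := by exact_mod_cast hN
  rw [mem_layer]
  refine ⟨one_lt_norm_of_mem_cube hN hw1 hxw, (norm_le_of_mem_cube hN hxw).trans ?_⟩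
  have h2 : (supNorm w : ℝ) ≤ 2 * N := by exact_mod_cast hw2
  calc (N : ℝ)⁻¹ * ((supNorm w : ℝ) + 1) ≤ (N : ℝ)⁻¹ * (2 * N + 1) := by gcongr
    _ = 2 + (N : ℝ)⁻¹ := by field_simp

/-- **INNER CONTAINMENT**: `{1 + 1/N ≤ ‖x‖_∞ ≤ 2} ⊆ tiled N`. [folklore] -/
theorem mem_tiled_of_norm {N : ℕ} (hN : 0 < N) {x : Fin 4 → ℝ} (h1 : 1 + (N : ℝ)⁻¹ ≤ ‖x‖) (h2 : ‖x‖ ≤ 2) :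
    x ∈ tiled N :=
  mem_tiled.mpr ⟨anchor N x, anchor_mem_annulus hN h1 h2, mem_cube_anchor hN x⟩

/-- The inner boundary layer: `shell \ tiled N ⊆ {1 < ‖x‖_∞ ≤ 1 + 1/N}`. [folklore] -/
theorem shell_sdiff_tiled_subset {N : ℕ} (hN : 0 < N) : shell \ tiled N ⊆ layer 1 (1 + (N : ℝ)⁻¹) := by
  rintro x ⟨hxS, hxT⟩
  rw [mem_shell] at hxS
  rw [mem_layer]
  refine ⟨hxS.1, ?_⟩
  by_contra h
  exact hxT (mem_tiled_of_norm hN (not_le.mp h).le hxS.2)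

/-- The outer boundary layer: `tiled N \ shell ⊆ {2 < ‖x‖_∞ ≤ 2 + 1/N}`. [folklore] -/
theorem tiled_sdiff_shell_subset {N : ℕ} (hN : 0 < N) : tiled N \ shell ⊆ layer 2 (2 + (N : ℝ)⁻¹) := by
  rintro x ⟨hxT, hxS⟩
  have h := mem_layer.mp (tiled_subset hN hxT)
  rw [mem_layer]
  refine ⟨?_, h.2⟩
  by_contra h2
  exact hxS (mem_shell.mpr ⟨h.1, not_lt.mp h2⟩)

/-- `tiled N ⊆ bigShell` (`N ≥ 1`). [folklore] -/
theorem tiled_subset_bigShell {N : ℕ} (hN : 0 < N) : tiled N ⊆ bigShell := fun x hx => by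
  have h := mem_layer.mp (tiled_subset hN hx)
  have hδ1 : (N : ℝ)⁻¹ ≤ 1 := inv_le_one_of_one_le₀ (by exact_mod_cast hN)
  rw [mem_bigShell]
  exact ⟨h.1.le, by linarith [h.2]⟩

/-- A cube anchored in the annulus lies in the big shell. [folklore] -/
theorem cube_subset_bigShell {N : ℕ} (hN : 0 < N) {w : Pt} (hw : w ∈ annulus 4 N (2 * N)) :
    cube N w ⊆ bigShell := fun _ hx => tiled_subset_bigShell hN (mem_tiled.mpr ⟨w, hw, hx⟩)

/-! ## 5. The estimate `|D(N) − ∫_shell F| ≤ (1280A + 20Λ)/N` -/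

/-- The integral over the tiled set is the sum of the cube integrals. [folklore] -/
theorem integral_tiled_eq_sum (hF : HomogKernel F A Λ) {N : ℕ} (hN : 0 < N) :
    ∫ x in tiled N, F x = ∑ w ∈ annulus 4 N (2 * N), ∫ x in cube N w, F x :=
  integral_biUnion_finset _ (fun w _ => measurableSet_cube N w) (fun _ _ _ _ hww' => disjoint_cube hN hww')
    (fun _ hw => (integrableOn_bigShell hF).mono_set (cube_subset_bigShell hN hw))

/-- **THE IN-CUBE ERROR**: `|∫_{Q_N(w)} F − F(w)| ≤ (Λ/32)·N⁻⁵` for `w` in the annulus. [folklore] -/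
theorem abs_integral_cube_sub_le (hF : HomogKernel F A Λ) {N : ℕ} (hN : 0 < N) {w : Pt}
    (hw : w ∈ annulus 4 N (2 * N)) :
    |(∫ x in cube N w, F x) - F (toReal w)| ≤ Λ / 32 * ((N : ℝ)⁻¹) ^ 5 := by
  have hNr : (0 : ℝ) < N := by exact_mod_cast hN
  have hΛ := hF.nonneg_Λ
  obtain ⟨hw1, hw2⟩ := mem_annulus_iff.mp hw
  have hw0 : w ≠ 0 := ne_zero_of_mem_annulus hw
  set a : Fin 4 → ℝ := (N : ℝ)⁻¹ • toReal w with ha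
  have ha_norm : ‖a‖ = (supNorm w : ℝ) / N := norm_anchor hN w
  have ha1 : 1 ≤ ‖a‖ := by
    rw [ha_norm, le_div_iff₀ hNr, one_mul]; exact_mod_cast hw1.le
  have ha4 : ‖a‖ ≤ 4 := by
    rw [ha_norm, div_le_iff₀ hNr]
    have : (supNorm w : ℝ) ≤ 2 * N := by exact_mod_cast hw2
    linarith
  have hvol : volume.real (cube N w) = ((N : ℝ)⁻¹) ^ 4 := by rw [measureReal_def, volume_cube_toReal hN]
  have hlt := volume_cube_lt_top N w
  have hint : IntegrableOn F (cube N w) volume :=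
    (integrableOn_bigShell hF).mono_set (cube_subset_bigShell hN hw)
  have hconst : ∫ _ in cube N w, F a = ((N : ℝ)⁻¹) ^ 4 * F a := by
    rw [setIntegral_const, smul_eq_mul, hvol]
  have hci : IntegrableOn (fun _ => F a) (cube N w) volume := integrableOn_const hlt.ne
  rw [← pow_mul_apply_anchor hF hN hw0, ← ha, ← hconst, ← integral_sub hint hci]
  have hbound : ∀ x ∈ cube N w, ‖F x - F a‖ ≤ Λ / 32 * (N : ℝ)⁻¹ := fun x hx => by
    have hxT := mem_bigShell.mp (cube_subset_bigShell hN hw hx)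
    rw [Real.norm_eq_abs]
    calc |F x - F a| ≤ Λ / 32 * ‖x - a‖ := abs_sub_le_bigShell hF hxT.1 hxT.2 ha1 ha4
      _ ≤ Λ / 32 * (N : ℝ)⁻¹ := by gcongr; exact norm_sub_anchor_le hN hx
  have h := norm_setIntegral_le_of_norm_le_const hlt hbound
  rw [Real.norm_eq_abs, hvol] at h
  calc |∫ x in cube N w, F x - F a| ≤ Λ / 32 * (N : ℝ)⁻¹ * ((N : ℝ)⁻¹) ^ 4 := h
    _ = Λ / 32 * ((N : ℝ)⁻¹) ^ 5 := by ring

/-- The lattice annulus has at most `(4N+1)⁴ ≤ 625N⁴` points. [folklore] -/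
theorem card_annulus_le {N : ℕ} (hN : 0 < N) : ((annulus 4 N (2 * N)).card : ℝ) ≤ 625 * (N : ℝ) ^ 4 := by
  have h1 : (annulus 4 N (2 * N)).card ≤ (box 4 (2 * N)).card := by
    rw [annulus]; exact Finset.card_le_card Finset.sdiff_subset
  rw [card_box] at h1
  have h2 : ((annulus 4 N (2 * N)).card : ℝ) ≤ ((2 * (2 * N) + 1 : ℕ) : ℝ) ^ 4 := by exact_mod_cast h1
  refine h2.trans ?_
  have hN1 : (1 : ℝ) ≤ N := by exact_mod_cast hN
  push_cast
  calc ((2 : ℝ) * (2 * N) + 1) ^ 4 ≤ (5 * N) ^ 4 := pow_le_pow_left₀ (by positivity) (by linarith) 4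
    _ = 625 * (N : ℝ) ^ 4 := by ring

/-- **SUM OF THE IN-CUBE ERRORS**: `|∫_{tiled N} F − D(N)| ≤ 20Λ/N`, where
`D(N) = Σ_{N<‖w‖_∞≤2N} F(w)` is `DyadicShell.dyadicSum (F∘toReal) N`. [folklore] -/
theorem abs_integral_tiled_sub_dyadicSum_le (hF : HomogKernel F A Λ) {N : ℕ} (hN : 0 < N) :
    |(∫ x in tiled N, F x) - dyadicSum (fun w => F (toReal w)) N| ≤ 20 * Λ * (N : ℝ)⁻¹ := by
  have hNr : (0 : ℝ) < N := by exact_mod_cast hN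
  have hΛ := hF.nonneg_Λ
  rw [integral_tiled_eq_sum hF hN, dyadicSum, ← Finset.sum_sub_distrib]
  refine (Finset.abs_sum_le_sum_abs _ _).trans ?_
  calc ∑ w ∈ annulus 4 N (2 * N), |(∫ x in cube N w, F x) - F (toReal w)|
      ≤ ∑ w ∈ annulus 4 N (2 * N), Λ / 32 * ((N : ℝ)⁻¹) ^ 5 :=
        Finset.sum_le_sum fun w hw => abs_integral_cube_sub_le hF hN hw
    _ = (annulus 4 N (2 * N)).card * (Λ / 32 * ((N : ℝ)⁻¹) ^ 5) := by rw [Finset.sum_const, nsmul_eq_mul]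
    _ ≤ 625 * (N : ℝ) ^ 4 * (Λ / 32 * ((N : ℝ)⁻¹) ^ 5) := by
        gcongr; exact card_annulus_le hN
    _ = 625 / 32 * Λ * (N : ℝ)⁻¹ := by field_simp
    _ ≤ 20 * Λ * (N : ℝ)⁻¹ := by
        have : 0 ≤ Λ * (N : ℝ)⁻¹ := by positivity
        nlinarith

/-- **THE BOUNDARY ERROR**: `|∫_shell F − ∫_{tiled N} F| ≤ 1280·A/N` (the two boundary layers have volume
`≤ 240/N` and `≤ 1040/N`, and `|F| ≤ A` there). [folklore] -/
theorem abs_integral_shell_sub_tiled_le (hF : HomogKernel F A Λ) {N : ℕ} (hN : 0 < N) :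
    |(∫ x in shell, F x) - ∫ x in tiled N, F x| ≤ 1280 * A * (N : ℝ)⁻¹ := by
  have hNr : (0 : ℝ) < N := by exact_mod_cast hN
  have hA := hF.nonneg_A
  set δ : ℝ := (N : ℝ)⁻¹ with hδ_def
  have hδ : 0 < δ := inv_pos.mpr hNr
  have hδ1 : δ ≤ 1 := inv_le_one_of_one_le₀ (by exact_mod_cast hN)
  have hS : IntegrableOn F shell volume := (integrableOn_bigShell hF).mono_set shell_subset_bigShell
  have hT : IntegrableOn F (tiled N) volume := (integrableOn_bigShell hF).mono_set (tiled_subset_bigShell hN)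
  have e1 := integral_inter_add_sdiff (measurableSet_tiled N) hS
  have e2 := integral_inter_add_sdiff measurableSet_shell hT
  rw [Set.inter_comm] at e2
  have e : (∫ x in shell, F x) - (∫ x in tiled N, F x) =
      (∫ x in shell \ tiled N, F x) - ∫ x in tiled N \ shell, F x := by linarith
  rw [e]
  -- the two pieces
  have b1 : |∫ x in shell \ tiled N, F x| ≤ A * volume.real (shell \ tiled N) := by
    have h := norm_setIntegral_le_of_norm_le_const (f := F) (s := shell \ tiled N) (C := A) (μ := volume)
      (lt_of_le_of_lt (measure_mono Set.sdiff_subset) (volume_layer_lt_top 1 2))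
      (fun x hx => by
        rw [Real.norm_eq_abs]; exact abs_le_of_one_le_norm hF (mem_shell.mp hx.1).1.le)
    rwa [Real.norm_eq_abs] at h
  have b2 : |∫ x in tiled N \ shell, F x| ≤ A * volume.real (tiled N \ shell) := by
    have h := norm_setIntegral_le_of_norm_le_const (f := F) (s := tiled N \ shell) (C := A) (μ := volume)
      (lt_of_le_of_lt (measure_mono (Set.sdiff_subset.trans (tiled_subset hN))) (volume_layer_lt_top _ _))
      (fun x hx => by
        rw [Real.norm_eq_abs]
        exact abs_le_of_one_le_norm hF (mem_layer.mp (tiled_subset hN hx.1)).1.le)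
    rwa [Real.norm_eq_abs] at h
  have v1 : volume.real (shell \ tiled N) ≤ (2 * (1 + δ)) ^ 4 - (2 * 1) ^ 4 := by
    rw [measureReal_def, ← volume_layer_toReal zero_le_one (by linarith)]
    exact ENNReal.toReal_mono (volume_layer_lt_top _ _).ne (measure_mono (shell_sdiff_tiled_subset hN))
  have v2 : volume.real (tiled N \ shell) ≤ (2 * (2 + δ)) ^ 4 - (2 * 2) ^ 4 := by
    rw [measureReal_def, ← volume_layer_toReal zero_le_two (by linarith)]
    exact ENNReal.toReal_mono (volume_layer_lt_top _ _).ne (measure_mono (tiled_sdiff_shell_subset hN))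
  have hδ2 : δ ^ 2 ≤ δ := by nlinarith
  have hδ3 : δ ^ 3 ≤ δ := by nlinarith
  have hδ4 : δ ^ 4 ≤ δ := by nlinarith
  have p1 : (2 * (1 + δ)) ^ 4 - (2 * 1) ^ 4 ≤ 240 * δ := by nlinarith
  have p2 : (2 * (2 + δ)) ^ 4 - (2 * 2) ^ 4 ≤ 1040 * δ := by nlinarith
  calc |(∫ x in shell \ tiled N, F x) - ∫ x in tiled N \ shell, F x|
      ≤ |∫ x in shell \ tiled N, F x| + |∫ x in tiled N \ shell, F x| := abs_sub _ _
    _ ≤ A * (240 * δ) + A * (1040 * δ) := by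
        refine add_le_add (b1.trans ?_) (b2.trans ?_)
        · exact mul_le_mul_of_nonneg_left (v1.trans p1) hA
        · exact mul_le_mul_of_nonneg_left (v2.trans p2) hA
    _ = 1280 * A * δ := by ring

/-- **THE ESTIMATE**: `|D(N) − ∫_shell F| ≤ (1280A + 20Λ)/N` for every `N ≥ 1`. [folklore] -/
theorem abs_dyadicSum_sub_integral_le (hF : HomogKernel F A Λ) {N : ℕ} (hN : 0 < N) :
    |dyadicSum (fun w => F (toReal w)) N - ∫ x in shell, F x| ≤ (1280 * A + 20 * Λ) * (N : ℝ)⁻¹ := by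
  have h1 := abs_integral_tiled_sub_dyadicSum_le hF hN
  have h2 := abs_integral_shell_sub_tiled_le hF hN
  rw [abs_sub_comm] at h1 h2
  calc |dyadicSum (fun w => F (toReal w)) N - ∫ x in shell, F x|
      = |(dyadicSum (fun w => F (toReal w)) N - ∫ x in tiled N, F x) +
          ((∫ x in tiled N, F x) - ∫ x in shell, F x)| := by ring_nf
    _ ≤ |dyadicSum (fun w => F (toReal w)) N - ∫ x in tiled N, F x| +
          |(∫ x in tiled N, F x) - ∫ x in shell, F x| := abs_add_le _ _
    _ ≤ 20 * Λ * (N : ℝ)⁻¹ + 1280 * A * (N : ℝ)⁻¹ := add_le_add h1 h2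
    _ = (1280 * A + 20 * Λ) * (N : ℝ)⁻¹ := by ring

/-! ## 6. The identification of the dyadic coefficient -/

/-- **MAIN THEOREM (rate form)**: the dyadic blocks of the shell sums of `F∘toReal` converge to `∫_shell F` at rate
`(1280A + 20Λ)·2^{−j}` — i.e. the continuum shell integral IS a `DyadicRate` limit for the class. [folklore] -/
theorem dyadicRate_integral (hF : HomogKernel F A Λ) :
    DyadicRate (shellSum fun w => F (toReal w)) (∫ x in shell, F x) (1280 * A + 20 * Λ) := by
  intro j
  rw [dyadicBlock_shellSum_eq]
  have hN : 0 < 2 ^ j := pow_pos two_pos j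
  refine (abs_dyadicSum_sub_integral_le hF hN).trans (le_of_eq ?_)
  push_cast
  rw [div_eq_mul_inv]

/-- **MAIN THEOREM (identification)**: ANY dyadic coefficient of the lattice restriction of a `HomogKernel` — in
particular the `I` of `DyadicShell.windowLog_of_homogKernel` / `LargeLWindow.WindowDecomposition.exists_rate` — equals
the continuum shell integral `∫_{1<‖x‖_∞≤2} F`. [folklore] -/
theorem coeff_eq_integral (hF : HomogKernel F A Λ) {I C : ℝ}
    (hI : DyadicRate (shellSum fun w => F (toReal w)) I C) : I = ∫ x in shell, F x :=
  dyadicRate_unique hI (dyadicRate_integral hF)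

/-- **THE WINDOW LOGARITHM WITH ITS CONTINUUM SLOPE**: `|Σ_{0<‖w‖_∞≤M} F(w) − (∫_shell F/log 2)·log M| ≤ 1312(A+Λ) +
|∫_shell F|` for all `M ≥ 1` (`DyadicShell.windowLog_of_homogKernel` with `I` identified). [folklore] -/
theorem windowLog_integral (hF : HomogKernel F A Λ) :
    ∀ M : ℕ, 1 ≤ M →
      |∑ w ∈ annulus 4 0 M, F (toReal w) - (∫ x in shell, F x) / Real.log 2 * Real.log M| ≤
        1312 * (A + Λ) + |∫ x in shell, F x| := by
  obtain ⟨I, hI, hlog⟩ := windowLog_of_homogKernel hF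
  rw [← coeff_eq_integral hF hI]
  exact hlog

/-! ## 7. The transverse structure: `unitCoeff μ ν = ∫_shell T_{μν}` -/

/-- **THE UNIT COEFFICIENT IS THE SHELL INTEGRAL OF THE TRANSVERSE STRUCTURE**:
`I₁(μ,ν) = ∫_{1<‖x‖_∞≤2} 24x_μ²x_ν²/|x|₂⁸ dx`. [folklore] -/
theorem unitCoeff_eq_integral (μ ν : Fin 4) : unitCoeff μ ν = ∫ x in shell, transverseUnit μ ν x :=
  coeff_eq_integral (homogKernel_transverseUnit μ ν) (unitCoeff_rate μ ν)

/-- Hence the shell integral of the transverse structure is `≥ 2⁻¹⁹`, in particular positive. [folklore] -/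
theorem integral_transverseUnit_ge (μ ν : Fin 4) : 1 / 524288 ≤ ∫ x in shell, transverseUnit μ ν x := by
  rw [← unitCoeff_eq_integral]; exact unitCoeff_ge μ ν

/-- `0 < ∫_shell T_{μν}`. [folklore] -/
theorem integral_transverseUnit_pos (μ ν : Fin 4) : 0 < ∫ x in shell, transverseUnit μ ν x := by
  rw [← unitCoeff_eq_integral]; exact unitCoeff_pos μ ν

/-- The coefficient of the leading integrand `κ·T` is `κ·∫_shell T`. [folklore] -/
theorem coeff_leadingIntegrand_eq (κ : ℝ) (μ ν : Fin 4) {I C : ℝ}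
    (hI : DyadicRate (shellSum fun w => leadingIntegrand κ μ ν (toReal w)) I C) :
    I = κ * ∫ x in shell, transverseUnit μ ν x := by
  rw [← unitCoeff_eq_integral]; exact LeadingCoefficient.coeff_eq_mul hI

/-- **CONSUMER (the VALUE binder as a definite integral)**: `LeadingCoefficient.logGrowthLower_of_value` with its
hypothesis `hval : unitCoeff μ ν = transverseValue` replaced by the calculus statement
`∫_{1<‖x‖_∞≤2} T_{μν} = 2π²·log 2`; that evaluation is NOT done in this file. [folklore] -/
theorem logGrowthLower_of_integral {β0 : ℕ → ℕ → ℝ} {Ch Cg A₁ c : ℝ} {M : ℕ → ℕ} {κ : ℝ} {μ ν : Fin 4}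
    (W : WindowDecomposition β0 (fun w => leadingIntegrand κ μ ν (toReal w)) Ch Cg A₁ c M) (hκ : 0 ≤ κ)
    (hval : ∫ x in shell, transverseUnit μ ν x = transverseValue) :
    LogGrowthLower β0 (2 * Real.pi ^ 2 * κ) (WindowDecomposition.constA Ch Cg A₁ c (κ * transverseValue)) :=
  logGrowthLower_of_value W hκ ((unitCoeff_eq_integral μ ν).trans hval)

end

end Literature.MathematicalPhysics.QuantumFieldTheory.Balaban1983to89.Beta.ShellRiemann
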